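import Literature.Geometry.Riemannian.SphericalCylinderEntropy
import Summits.SmoothPoincare4.SmoothPoincare4.Theses.CylinderEntropy

/-!
# SmoothPoincare4 / CylinderEntropy — the area floor (item stmt-SmoothPoincare4-7635)

Settles the support item `AreaFloor` of route CylinderEntropy: if `ι : M → ℝ⁶` is a smooth embedding
of a 4-manifold into the round cylinder `N = {z ∈ ℝ⁶ | ∑_{i<5} zᵢ² = 1} ≅ S⁴ × ℝ` whose image
separates the two ends of `N` (no path in `N ∖ range ι` from height `≤ -R` to height `≥ R`), then
`μH[4](S⁴ ⊂ ℝ⁵) ≤ μH[4](range ι)`.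

Proof: this is the set-level statement
`Literature.Geometry.Riemannian.SphericalCylinderEntropy.hausdorffMeasure_sphere_le_of_separatesEnds`
applied to `A = range ι` — the coordinate projection `ℝ⁶ → ℝ⁵` forgetting the height is 1-Lipschitz,
so it does not increase `μH[4]` (Federer 2.10.11, Mathlib `LipschitzWith.hausdorffMeasure_image_le`),
and its image of `range ι` contains the whole unit sphere, since a missed point `q ∈ S⁴` would give the
vertical segment `{q} × [-(|R|+1), |R|+1] ⊂ N ∖ range ι` joining the two ends, contradicting separation.
Only the separation hypothesis is used: the smooth-embedding hypothesis, the manifold structure on `M`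
and `range ι ⊆ N` are not needed (as the route-review refuter and the grounder observed).

References: H. Federer, *Geometric Measure Theory* (1969), 2.10.11 [Federer1969].
-/

-- the registered namespace `Summit.SmoothPoincare4.SmoothPoincare4.Theorems` repeats a component
set_option linter.dupNamespace false

namespace Summit.SmoothPoincare4.SmoothPoincare4.Theorems

open Summit.SmoothPoincare4.SmoothPoincare4.Theses.CylinderEntropy

/-- Settles stmt-SmoothPoincare4-7635 (`CylinderEntropy.AreaFloor`): for a smooth embedding
`ι : M⁴ → ℝ⁶` with image in the round cylinder `N = S⁴ × ℝ` separating the two ends of `N`,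
`μH[4](S⁴ ⊂ ℝ⁵) ≤ μH[4](range ι)`.  Proof: unfold and apply the set-level area floor
`hausdorffMeasure_sphere_le_of_separatesEnds` (1-Lipschitz height-forgetting projection whose image of
`range ι` covers `S⁴` by the vertical-segment separation argument) to `A = range ι`; only the
separation hypothesis is used. [cite: Federer1969, 2.10.11] -/
theorem AreaFloor_proof :
    Summit.SmoothPoincare4.SmoothPoincare4.Theses.CylinderEntropy.AreaFloor := by
  unfold AreaFloor
  intro M _ _ _ _ _ ι _ _ hsep
  obtain ⟨R, hR⟩ := hsep
  exact Literature.Geometry.Riemannian.SphericalCylinderEntropy.hausdorffMeasure_sphere_le_of_separatesEnds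
    hR

end Summit.SmoothPoincare4.SmoothPoincare4.Theorems
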